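import Summits.ValiantsHypothesis.ValiantsHypothesis.Theorems.RefutationDegreeBeyondHessianSosPlusOne
import Summits.ValiantsHypothesis.ValiantsHypothesis.Theorems.RefutationDegreeBeyondHessianSosStubBorderExpansion
import Summits.ValiantsHypothesis.ValiantsHypothesis.Theorems.RefutationDegreeBeyondHessianSosStubSliceDim
import Summits.ValiantsHypothesis.ValiantsHypothesis.Theorems.RefutationDegreeBeyondHessianSosStubNilconeSlice
import Summits.ValiantsHypothesis.ValiantsHypothesis.Theorems.RefutationDegreeBeyondHessianSosStubCubicNullBound
import Summits.ValiantsHypothesis.ValiantsHypothesis.Theorems.RefutationDegreeBeyondHessianSosStubKneserProduct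

/-!
# Crux `RefutationDegree.BeyondHessianSos` (stmt-ValiantsHypothesis-5643), line `Sketch` —
# beyond Mignon–Ressayre by a constant factor: `9 dc(per_n) ≥ 5n² - 28n + 50`, and the semantic half of the crux

`…PlusOne.lean` proved `n² + 2 ≤ 2M` for every affine determinantal representation of `per_n` of
size `M` (`n ≥ 3`), which settles the infeasibility of `Rep(n, ⌊n²/2⌋ + 1)` for ODD `n` and leaves
even `n` one short.  This file proves, for every `n ≥ 4` and every such representation,

  **`5n² + 50 ≤ 9M + 28n`**, i.e. `dc(per_n) ≥ (5n² - 28n + 50)/9`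
  (`five_mul_sq_add_le_of_hasDetRepr_perPoly`, `five_mul_sq_add_le_determinantalComplexity_perPoly`),

an improvement of the LEADING CONSTANT of the Mignon–Ressayre bound `dc(per_n) ≥ n²/2` (2004) from
`1/2` to `5/9` (it overtakes `⌊n²/2⌋ + 1` at `n = 55`; e.g. `dc(per_100) ≥ 5250`).  Consequences:
`n² + 3 ≤ 2M` for `n ≥ 55` (`sq_add_three_le_two_mul_of_hasDetRepr_perPoly`), hence
`dc(per_n) ≥ ⌊n²/2⌋ + 2` (`sq_div_two_add_two_le_determinantalComplexity_perPoly`, registered stub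
`stub_plusTwo`) and the infeasibility of `Rep(n, ⌊n²/2⌋ + 1)` for EVERY `n ≥ 55`
(`not_hasDetRepr_perPoly_sq_div_two_add_one`) — the semantic half of the cruxes `BeyondHessianSos` /
`BeyondHessianNs` of route `RefutationDegree`, whose remaining content is the certificate DEGREE.

## The argument (`nine_mul_finrank_flat_le`)

A representation of size `M` puts a LINEAR subspace `W ∋ y₀` of dimension `≥ n² - M + 1` inside
the permanental hypersurface, `y₀ = J - n E₀₀` the Mignon–Ressayre point
(`EvenTransfer.exists_flat_of_hasDetRepr_perPoly`, file `…StubEvenTransfer.lean`).  Such flats are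
small: `9 dim W ≤ 4(n-1)² + 36(n-1) - 9`, with NO use of the Hessian.  Write `n = m + 1`.
1. BORDER SLICING (`stub_borderExpansion`, `stub_sliceDim`): the elements of `W` whose row `0` and
   column `0` vanish off the corner have vanishing corner and a lower-right block `B` with
   `per_m(J + B) = m!` (Laplace along the border: `per_n(s y₀ + v) = (s(1-n)+a)P(s) + s²P'(s)` with
   `P(s) = per_m(sJ + B)` forces `a = 0`, `P = m! s^m`); so `dim W ≤ dim L + 2m` for a linear space
   `L` of `m × m` matrices on which `per_m(J + ·) ≡ m!` (the "`J`-nilcone").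
2. ROW/COLUMN-SUM SLICING (`stub_nilconeSlice`): on matrices with zero row and column sums the
   second and third subpermanent sums are `½ Σ X²` and `⅔ Σ X³`, so `A := L ∩ PP` is a linear
   subspace of `ℂ^{m²}` on which the power sums `p₂, p₃` vanish, and `dim L ≤ dim A + 2m - 1`.
3. KNESER (`stub_cubicNullBound` from `stub_kneserProduct`, Kneser's theorem for coordinatewise
   products of subspaces, Mirandola–Zémor 2015 Thm 3.3): such `A` have `9 dim A ≤ 4 m²` (with
   `P = A∘A`: `2 dim A ≤ dim P + dim St(P)`, `dim A + dim P ≤ m²` as `A ⊥ A + P`, and every class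
   of the stabiliser algebra has `≥ 3` points).
Hence `9M ≥ 9n² + 9 - 9 dim W ≥ 5n² - 28n + 50`.
-/

set_option linter.dupNamespace false

noncomputable section

open scoped BigOperators
open MvPolynomial

namespace Summit.ValiantsHypothesis.ValiantsHypothesis.Theorems.RefutationDegreeBeyondHessianSos

open Literature.Computability.AlgebraicComplexity Module

/-- **Flats of the permanental hypersurface through the Mignon–Ressayre point are small.** For
`p ≥ 1` (block size `m = p + 2 ≥ 3`), every linear subspace `W ∋ y₀` of `(p+3) × (p+3)` matrix
space on which `per_{p+3}` vanishes identically has `9 dim W ≤ 4(p+2)² + 36(p+2) - 9` (steps 1–3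
of the module docstring; no parity assumption, no Hessian). -/
theorem nine_mul_finrank_flat_le (p : ℕ) (hp : 1 ≤ p)
    (W : Submodule ℂ (Fin (p + 3) × Fin (p + 3) → ℂ)) (hy : mrPoint ℂ p ∈ W)
    (hZ : ∀ w ∈ W, MvPolynomial.eval w (perPoly (Fin (p + 3)) ℂ) = 0) :
    9 * finrank ℂ W + 9 ≤ 4 * (p + 2) ^ 2 + 36 * (p + 2) := by
  -- border-free elements of `W`: `per(s y₀ + v) = 0` for all `s`
  have hline : ∀ v ∈ W, ∀ s : ℂ,
      MvPolynomial.eval (s • mrPoint ℂ p + v) (perPoly (Fin (p + 3)) ℂ) = 0 :=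
    fun v hv s => hZ _ (W.add_mem (W.smul_mem s hy) hv)
  have hcorner : ∀ v ∈ W, (∀ j : Fin (p + 2), v (0, j.succ) = 0) →
      (∀ i : Fin (p + 2), v (i.succ, 0) = 0) → v (0, 0) = 0 :=
    fun v hv hr hc => (stub_borderExpansion p v hr hc (hline v hv)).1
  obtain ⟨L, hL, hdimW⟩ := stub_sliceDim p W hcorner
  -- the blocks lie in the `J`-nilcone
  have hnil : ∀ B ∈ L, MvPolynomial.eval (fun ij : Fin (p + 2) × Fin (p + 2) => 1 + B ij)
      (perPoly (Fin (p + 2)) ℂ) = (Nat.factorial (p + 2) : ℂ) := by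
    intro B hB
    obtain ⟨v, hv, hr, hc, hblock⟩ := hL B hB
    have h2 := (stub_borderExpansion p v hr hc (hline v hv)).2
    have hfun : (fun ij : Fin (p + 2) × Fin (p + 2) => 1 + v (ij.1.succ, ij.2.succ)) =
        fun ij : Fin (p + 2) × Fin (p + 2) => 1 + B ij := by
      funext ij
      obtain ⟨i, j⟩ := ij
      rw [hblock i j]
    rw [hfun] at h2
    exact h2
  -- slice by zero row/column sums, then the Kneser bound
  obtain ⟨A, hA2, hA3, hdimL⟩ := stub_nilconeSlice (p + 2) (by omega) L hnil
  have hA := stub_cubicNullBound stub_kneserProduct A hA2 hA3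
  rw [Fintype.card_prod, Fintype.card_fin] at hA
  -- 9 dim W ≤ 9 dim L + 18m ≤ 9 dim A + 36m - 9 ≤ 4m² + 36m - 9
  nlinarith [hdimW, hdimL, hA]

/-- **Beyond Mignon–Ressayre by a constant factor.** For `n = p + 3 ≥ 4` and every affine
determinantal representation of `per_n` over `ℂ` of size `M`: `5n² + 50 ≤ 9M + 28n`, i.e.
`dc(per_n) ≥ (5n² - 28n + 50)/9` (the kernel flat of the representation through `y₀` has
`dim ≥ n² - M + 1`, `EvenTransfer.exists_flat_of_hasDetRepr_perPoly`, and is small by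
`nine_mul_finrank_flat_le`). -/
theorem five_mul_sq_add_le_of_hasDetRepr_perPoly {p M : ℕ} (hp : 1 ≤ p)
    (h : HasDetRepr (perPoly (Fin (p + 3)) ℂ) M) :
    5 * (p + 3) ^ 2 + 50 ≤ 9 * M + 28 * (p + 3) := by
  obtain ⟨W, hy, hZ, hdim⟩ := EvenTransfer.exists_flat_of_hasDetRepr_perPoly h
  have hflat := nine_mul_finrank_flat_le p hp W hy hZ
  nlinarith [hflat, hdim]

/-- The same bound in terms of `n ≥ 4`: `5n² + 50 ≤ 9M + 28n`. -/
theorem five_mul_sq_add_le_of_hasDetRepr_perPoly' {n M : ℕ} (hn : 4 ≤ n)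
    (h : HasDetRepr (perPoly (Fin n) ℂ) M) : 5 * n ^ 2 + 50 ≤ 9 * M + 28 * n := by
  obtain ⟨p, rfl⟩ : ∃ p, n = p + 3 := ⟨n - 3, by omega⟩
  exact five_mul_sq_add_le_of_hasDetRepr_perPoly (by omega) h

/-- **`9 dc(per_n) + 28n ≥ 5n² + 50` over `ℂ` for every `n ≥ 4`** — leading constant `5/9`
instead of Mignon–Ressayre's `1/2` (the infimum is attained by Valiant universality,
`exists_hasDetRepr_holds`). -/
theorem five_mul_sq_add_le_determinantalComplexity_perPoly {n : ℕ} (hn : 4 ≤ n) :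
    5 * n ^ 2 + 50 ≤ 9 * determinantalComplexity (perPoly (Fin n) ℂ) + 28 * n := by
  have hne : {M : ℕ | HasDetRepr (perPoly (Fin n) ℂ) M}.Nonempty := exists_hasDetRepr_holds _
  exact five_mul_sq_add_le_of_hasDetRepr_perPoly' hn (Nat.sInf_mem hne)

/-- **Mignon–Ressayre plus two, in the `2M` scale.** For `n ≥ 55`, every affine determinantal
representation of `per_n` over `ℂ` of size `M` has `n² + 3 ≤ 2M` (from `5n² + 50 ≤ 9M + 28n` and
`n² - 56n + 73 ≥ 0`). -/
theorem sq_add_three_le_two_mul_of_hasDetRepr_perPoly {n M : ℕ} (hn : 55 ≤ n)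
    (h : HasDetRepr (perPoly (Fin n) ℂ) M) : n ^ 2 + 3 ≤ 2 * M := by
  have h1 := five_mul_sq_add_le_of_hasDetRepr_perPoly' (by omega) h
  obtain ⟨k, rfl⟩ : ∃ k, n = k + 55 := ⟨n - 55, by omega⟩
  nlinarith [h1, sq_nonneg k]

/-- Floor form: `⌊n²/2⌋ + 2 ≤ M` for every affine determinantal representation of `per_n` of size
`M` over `ℂ`, `n ≥ 55`. -/
theorem sq_div_two_add_two_le_of_hasDetRepr_perPoly {n M : ℕ} (hn : 55 ≤ n)
    (h : HasDetRepr (perPoly (Fin n) ℂ) M) : n ^ 2 / 2 + 2 ≤ M := by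
  have h1 := sq_add_three_le_two_mul_of_hasDetRepr_perPoly hn h
  omega

/-- **The semantic half of the crux, all parities.** For every `n ≥ 55`, `per_n` has no affine
determinantal representation of size `⌊n²/2⌋ + 1` over `ℂ`: the system `Rep(n, ⌊n²/2⌋ + 1)` of
route `RefutationDegree` is infeasible (odd `n ≥ 3` was `…PlusOne.lean`). -/
theorem not_hasDetRepr_perPoly_sq_div_two_add_one {n : ℕ} (hn : 55 ≤ n) :
    ¬ HasDetRepr (perPoly (Fin n) ℂ) (n ^ 2 / 2 + 1) := fun h => by
  have := sq_div_two_add_two_le_of_hasDetRepr_perPoly hn h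
  omega

/-- **Registered stub `stub_plusTwo` of the crux item** (the form recorded on the ledger): for
`n ≥ 55`, `⌊n²/2⌋ + 2 ≤ M` for every size-`M` affine determinantal representation of `per_n`
over `ℂ`. -/
theorem stub_plusTwo (n M : ℕ) (hn : 55 ≤ n) (h : HasDetRepr (perPoly (Fin n) ℂ) M) :
    n ^ 2 / 2 + 2 ≤ M :=
  sq_div_two_add_two_le_of_hasDetRepr_perPoly hn h

/-- **`dc(per_n) ≥ ⌊n²/2⌋ + 2` over `ℂ` for every `n ≥ 55`** (the infimum is attained by Valiant
universality, `exists_hasDetRepr_holds`): two more than Mignon–Ressayre for even `n`, one more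
for odd `n`. -/
theorem sq_div_two_add_two_le_determinantalComplexity_perPoly {n : ℕ} (hn : 55 ≤ n) :
    n ^ 2 / 2 + 2 ≤ determinantalComplexity (perPoly (Fin n) ℂ) := by
  have hne : {M : ℕ | HasDetRepr (perPoly (Fin n) ℂ) M}.Nonempty := exists_hasDetRepr_holds _
  exact sq_div_two_add_two_le_of_hasDetRepr_perPoly hn (Nat.sInf_mem hne)

end Summit.ValiantsHypothesis.ValiantsHypothesis.Theorems.RefutationDegreeBeyondHessianSos

end
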